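import Summits.CriticalPhenomena.PercolationContinuityZ3.Theorems.FK.InfiniteVolumeOneEdgeTransport
import Summits.CriticalPhenomena.PercolationContinuityZ3.Theorems.FK.RandomClusterOneEdgeConditional
import Summits.CriticalPhenomena.PercolationContinuityZ3.Theorems.FK.FreeEdwardsSokalTwoPoint
import HarnessLib

/-!
# FK-continuity transplant, FO-06 (construction half): the DLR (Gibbs) property of the box limits
# `φ^b_{p,q}` in the one-edge form — Grimmett 2006, Thm. (4.34)(b) with Prop. (4.37), eq. (4.38);
# part 1: finite volume, transport, and the half that needs no uniqueness

Cell `fk-continuity` (bschramm), row FO-06b-5; support file for the FK-continuity transplant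
(`--supports stmt-CriticalPhenomena-4575`); builds on p205010 (kernel theorem, internal audit signed;
external expert review pending). No named facts, no sorries, standard axioms. General dimension `d`,
both boundary conditions `b`.

Grimmett 2006, Thm. (4.34)(b): for `q ≥ 1` the limit measures `φ^b_{p,q}` (`b = 0, 1`) are
DLR-random-cluster measures, i.e. (Def. (4.29), eq. (4.30)) their conditional law inside a finite
region given the outside is the finite-volume random-cluster measure with the induced boundary
condition; by Prop. (4.37)(b) it is equivalent to ask this for single edges, where it reads
(eq. (4.38)): for every edge `e = ⟨x,y⟩`,
`φ(e open | T_e)(ω) = p` if `ω ∈ K_e` and `= p/(p + q(1-p))` if `ω ∉ K_e`,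
`K_e = {x and y are joined by an open path not using e}`, `T_e` the σ-field of the other edges.

This file and its sequel `InfiniteVolumeOneEdgeDLRClosed.lean` prove (4.38), integrated against
events `H ∈ T_e` determined by finitely many edges, for EVERY box limit `P` of the cell
(`IsBoxLimit d b p q P`, `InfiniteVolumeDefs.lean`; `0 ≤ p ≤ 1`), following Grimmett's proof of
Thm. (4.31) (pp. 84–86) specialised to one edge. Here (part 1):

* (transport and the exit lemma are in `InfiniteVolumeOneEdgeTransport.lean`) the exact finite-volume
  identities (`RandomClusterOneEdgeConditional.lean`, Grimmett's (3.3)) for the box laws: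
  `rcBoxLaw_real_edgeOpen_inter_eq_mul_of_openConnVia` and the sandwich
  `rcBoxLaw_real_edgeOpen_inter_sub_mul_mem_Icc`;
* the deterministic heart of Lemma (4.39): if the endpoints of `e` are joined off `e` in the box
  `Λ_n` (through the wired boundary if `b = 1`) but not inside `Λ_m`, then both are joined inside
  `Λ_{m+1}` to sites outside `Λ_m` (`exists_exit_of_reachable_sup_wired`), a LOCAL event;
* **the `K_e` half of (4.38), which needs no uniqueness** (`q > 0`):
  `IsBoxLimit.real_edgeOpen_inter_offEdgeConn_eq_mul` —
  `P(J_e ∩ H ∩ K_e) = p · P(H ∩ K_e)` (`J_e = {e open}`), and its finite-box approximants.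

The `K_eᶜ` half (`= p/(p+q(1-p)) · P(H ∖ K_e)`) needs the almost-sure uniqueness of the infinite
cluster (the 0/1-infinite-cluster property of Thm. (4.31)) and is the sequel's
`IsBoxLimit.real_edgeOpen_inter_not_offEdgeConn_eq_mul`.

## References

* G. Grimmett, *The Random-Cluster Model*, Springer 2006: Thm. (3.1)(a) eq. (3.3) p. 38; Lemma (4.13)
  p. 71; Def. (4.29)–(4.30), Thm. (4.31), (4.33), (4.34)(b) pp. 81–82; Prop. (4.37) eq. (4.38) p. 82;
  Lemma (4.39) and the proof of Thm. (4.31), pp. 83–86. [Grimmett2006]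
-/

noncomputable section

open MeasureTheory Set Filter
open scoped Topology ENNReal

namespace Summit.CriticalPhenomena.PercolationContinuityZ3.Theorems.FK

open Literature.Probability.Percolation Literature.Probability.LatticeModels

variable {d : ℕ}

/-! ### Finite volume: the box laws -/

section FiniteVolume

variable {b : Bool} {p q : ℝ}

/-- **Exact one-edge identity for the box laws, joined case** (Grimmett 2006, (3.3) read on `ℤ^d`):
for `x ~ y` in `Λ_m ⊆ Λ_n` and any event `H` determined by a set of pairs not containing
`e = s(x,y)`, with `L_m = {x ↔ y inside Λ_m, off e}`:
`φ^b_{Λ_n}({e open} ∩ H ∩ L_m) = p · φ^b_{Λ_n}(H ∩ L_m)`. [cite: Grimmett2006, Thm. (3.1)(a) eq. (3.3) and Lemma (4.13)] -/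
theorem rcBoxLaw_real_edgeOpen_inter_eq_mul_of_openConnVia (b : Bool) (hp : p ∈ Set.Icc (0 : ℝ) 1)
    (hq : 0 < q) {m n : ℕ} (hmn : m ≤ n) {x y : Site d} (hxy : (zdGraph d).Adj x y)
    (hx : x ∈ box d m) (hy : y ∈ box d m) {H : Set (BondConfig (Site d))}
    {T : Set (Sym2 (Site d))} (hH : DeterminedBy H T) (heT : s(x, y) ∉ T) (hHm : MeasurableSet H) :
    (rcBoxLaw d b p q n).real ({ω | s(x, y) ∈ ω} ∩ H ∩
        (fun η => η \ {s(x, y)}) ⁻¹' openConnVia (withinGraph ⊤ (↑(box d m) : Set (Site d))) x y) =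
      p * (rcBoxLaw d b p q n).real
        (H ∩ (fun η => η \ {s(x, y)}) ⁻¹' openConnVia (withinGraph ⊤ (↑(box d m) : Set (Site d))) x y) := by
  have hxn : x ∈ box d n := box_mono d hmn hx
  have hyn : y ∈ box d n := box_mono d hmn hy
  have hKm : MeasurableSet (openConnVia (withinGraph ⊤ (↑(box d m) : Set (Site d))) x y) :=
    measurableSet_openConnVia _ x y
  have hf : Measurable fun η : BondConfig (Site d) => η \ {s(x, y)} := measurable_closeEdges _
  have hLm : MeasurableSet (H ∩ (fun η => η \ {s(x, y)}) ⁻¹'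
      openConnVia (withinGraph ⊤ (↑(box d m) : Set (Site d))) x y) := hHm.inter (hKm.preimage hf)
  have hJm : MeasurableSet ({ω : BondConfig (Site d) | s(x, y) ∈ ω} ∩ H ∩ (fun η => η \ {s(x, y)}) ⁻¹'
      openConnVia (withinGraph ⊤ (↑(box d m) : Set (Site d))) x y) :=
    ((measurableSet_mem _).inter hHm).inter (hKm.preimage hf)
  have he' : s((⟨x, hxn⟩ : ↥(box d n)), ⟨y, hyn⟩) ∈ (finsetGraph (zdGraph d) (box d n)).edgeFinset := by
    rw [SimpleGraph.mem_edgeFinset, SimpleGraph.mem_edgeSet, finsetGraph_adj_iff]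
    exact hxy
  rw [rcBoxLaw_real_apply b p q n hJm, rcBoxLaw_real_apply b p q n hLm, Set.inter_assoc,
    liftEdges_preimage_setOf_mem_inter hxn hyn, rcBoxMeasure]
  -- the pulled-back event is determined off the copy of `e`, and on it the endpoints are joined off `e`
  refine rcMeasure_real_inter_edgeOpen_eq_mul_of_joined _ hp hq (boxBC d b n) he' ?_ ?_
  · intro ω
    refine insert_mem_preimage_liftEdges_iff hxn hyn (fun ω' => ?_) ω
    rw [Set.mem_inter_iff, Set.mem_inter_iff, insert_mem_iff_of_determinedBy hH heT,
      insert_mem_preimage_diff_singleton_iff]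
  · intro ω hω
    rw [Set.mem_preimage, Set.mem_inter_iff, Set.mem_preimage, ← liftEdges_diff_singleton_mk hxn hyn] at hω
    have h1 : liftEdges (box d n) (ω \ {s((⟨x, hxn⟩ : ↥(box d n)), ⟨y, hyn⟩)}) ∈ openConn x y :=
      openClusterIn_subset_openCluster _ _ x hω.2
    have h2 : ω \ {s((⟨x, hxn⟩ : ↥(box d n)), ⟨y, hyn⟩)} ∈
        openConn (⟨x, hxn⟩ : ↥(box d n)) ⟨y, hyn⟩ := by
      rw [← liftEdges_preimage_openConn (box d n) hxn hyn]; exact h1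
    exact SimpleGraph.Reachable.mono le_sup_left h2

set_option maxHeartbeats 400000 in
/-- **Sandwich for the box laws, separated case** (Grimmett 2006, (3.3) + the exit lemma): for `x ~ y`
in `Λ_m`, `m + 1 ≤ n`, `H` determined by pairs other than `e = s(x,y)`, `M_m = {¬ x ↔ y inside Λ_m
off e}` and the exit events `Y_m(z) = {z joined inside Λ_{m+1} off e to a site of Λ_{m+1} ∖ Λ_m}`:
`0 ≤ φ^b_{Λ_n}({e open} ∩ H ∩ M_m) - p'·φ^b_{Λ_n}(H ∩ M_m) ≤ (p - p')·φ^b_{Λ_n}(Y_m(x) ∩ Y_m(y) ∩ M_m)`,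
`p' = p/(p+q(1-p))` (`q ≥ 1`; on `H ∩ M_m` the conditional probability of `{e open}` is `p'` unless
`x, y` are joined off `e` through `Λ_n ∖ Λ_m` or the wired boundary, an event inside
`Y_m(x) ∩ Y_m(y)` on lattice configurations, where it is `p ≥ p'`).
[cite: Grimmett2006, Thm. (3.1)(a) eq. (3.3), Lemma (4.13), Lemma (4.39) eq. (4.41)] -/
theorem rcBoxLaw_real_edgeOpen_inter_sub_mul_mem_Icc (b : Bool) (hp : p ∈ Set.Icc (0 : ℝ) 1)
    (hq : 1 ≤ q) {m n : ℕ} (hmn : m + 1 ≤ n) {x y : Site d} (hxy : (zdGraph d).Adj x y)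
    (hx : x ∈ box d m) (hy : y ∈ box d m) {H : Set (BondConfig (Site d))}
    {T : Set (Sym2 (Site d))} (hH : DeterminedBy H T) (heT : s(x, y) ∉ T) (hHm : MeasurableSet H) :
    (rcBoxLaw d b p q n).real ({ω | s(x, y) ∈ ω} ∩ H ∩
        ((fun η => η \ {s(x, y)}) ⁻¹' openConnVia (withinGraph ⊤ (↑(box d m) : Set (Site d))) x y)ᶜ) -
      p / (p + q * (1 - p)) * (rcBoxLaw d b p q n).real
        (H ∩ ((fun η => η \ {s(x, y)}) ⁻¹' openConnVia (withinGraph ⊤ (↑(box d m) : Set (Site d))) x y)ᶜ) ∈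
      Set.Icc 0 ((p - p / (p + q * (1 - p))) * (rcBoxLaw d b p q n).real
        ((fun η => η \ {s(x, y)}) ⁻¹' {ω | ∃ c ∈ box d (m + 1), c ∉ box d m ∧
            ω ∈ openConnVia (withinGraph ⊤ (↑(box d (m + 1)) : Set (Site d))) x c} ∩
          (fun η => η \ {s(x, y)}) ⁻¹' {ω | ∃ c ∈ box d (m + 1), c ∉ box d m ∧
            ω ∈ openConnVia (withinGraph ⊤ (↑(box d (m + 1)) : Set (Site d))) y c} ∩
          ((fun η => η \ {s(x, y)}) ⁻¹'
            openConnVia (withinGraph ⊤ (↑(box d m) : Set (Site d))) x y)ᶜ)) := by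
  classical
  have hq0 : 0 < q := one_pos.trans_le hq
  have hmn' : m ≤ n := (Nat.le_succ m).trans hmn
  have hxn : x ∈ box d n := box_mono d hmn' hx
  have hyn : y ∈ box d n := box_mono d hmn' hy
  -- abbreviations
  set f : BondConfig (Site d) → BondConfig (Site d) := fun η => η \ {s(x, y)} with hf
  set K := openConnVia (withinGraph ⊤ (↑(box d m) : Set (Site d))) x y with hK
  set Yx := {ω : BondConfig (Site d) | ∃ c ∈ box d (m + 1), c ∉ box d m ∧
      ω ∈ openConnVia (withinGraph ⊤ (↑(box d (m + 1)) : Set (Site d))) x c} with hYx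
  set Yy := {ω : BondConfig (Site d) | ∃ c ∈ box d (m + 1), c ∉ box d m ∧
      ω ∈ openConnVia (withinGraph ⊤ (↑(box d (m + 1)) : Set (Site d))) y c} with hYy
  set L := liftEdges (box d n) with hL
  set e' : Sym2 ↥(box d n) := s(⟨x, hxn⟩, ⟨y, hyn⟩) with he'def
  set G := finsetGraph (zdGraph d) (box d n) with hG
  set φ := rcBoxMeasure d b p q n with hφ
  have hf_meas : Measurable f := measurable_closeEdges _
  have hKm : MeasurableSet K := measurableSet_openConnVia _ x y
  have hMm : MeasurableSet (H ∩ (f ⁻¹' K)ᶜ) := hHm.inter (hKm.preimage hf_meas).compl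
  have hJm : MeasurableSet ({ω : BondConfig (Site d) | s(x, y) ∈ ω} ∩ H ∩ (f ⁻¹' K)ᶜ) :=
    ((measurableSet_mem _).inter hHm).inter (hKm.preimage hf_meas).compl
  have hYxm : MeasurableSet Yx := measurableSet_of_isLocalEvent_holds (isLocalEvent_exit m x)
  have hYym : MeasurableSet Yy := measurableSet_of_isLocalEvent_holds (isLocalEvent_exit m y)
  have hDm : MeasurableSet (f ⁻¹' Yx ∩ f ⁻¹' Yy ∩ (f ⁻¹' K)ᶜ) :=
    ((hYxm.preimage hf_meas).inter (hYym.preimage hf_meas)).inter (hKm.preimage hf_meas).compl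
  have he' : e' ∈ G.edgeFinset := by
    rw [SimpleGraph.mem_edgeFinset, SimpleGraph.mem_edgeSet, finsetGraph_adj_iff]
    exact hxy
  -- the finite-volume events
  set C : Set (BondConfig ↥(box d n)) :=
    {ω | (openGraph (ω \ {e'}) ⊔ wired (boxBC d b n)).Reachable ⟨x, hxn⟩ ⟨y, hyn⟩} with hC
  set S := L ⁻¹' (H ∩ (f ⁻¹' K)ᶜ) with hS
  -- `S` is determined off `e'`, and so are `S ∩ C`, `S ∩ Cᶜ`
  have hSinv : ∀ ω, insert e' ω ∈ S ↔ ω ∈ S := by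
    intro ω
    refine insert_mem_preimage_liftEdges_iff hxn hyn (fun ω' => ?_) ω
    rw [Set.mem_inter_iff, Set.mem_inter_iff, insert_mem_iff_of_determinedBy hH heT, Set.mem_compl_iff,
      Set.mem_compl_iff, insert_mem_preimage_diff_singleton_iff]
  have hCinv : ∀ ω, insert e' ω ∈ C ↔ ω ∈ C := by
    intro ω
    simp only [hC, Set.mem_setOf_eq, Set.insert_sdiff_of_mem _ (Set.mem_singleton e')]
  have hSCinv : ∀ ω, insert e' ω ∈ S ∩ C ↔ ω ∈ S ∩ C := fun ω => by
    rw [Set.mem_inter_iff, Set.mem_inter_iff, hSinv, hCinv]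
  have hSCcinv : ∀ ω, insert e' ω ∈ S ∩ Cᶜ ↔ ω ∈ S ∩ Cᶜ := fun ω => by
    rw [Set.mem_inter_iff, Set.mem_inter_iff, hSinv, Set.mem_compl_iff, Set.mem_compl_iff, hCinv]
  -- Grimmett's (3.3) on the two pieces
  have h1 : φ.real (S ∩ C ∩ {ω | e' ∈ ω}) = p * φ.real (S ∩ C) :=
    rcMeasure_real_inter_edgeOpen_eq_mul_of_joined G hp hq0 (boxBC d b n) he' hSCinv (fun ω hω => hω.2)
  have h2 : φ.real (S ∩ Cᶜ ∩ {ω | e' ∈ ω}) = p / (p + q * (1 - p)) * φ.real (S ∩ Cᶜ) :=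
    rcMeasure_real_inter_edgeOpen_eq_mul_of_not_joined G hp hq0 (boxBC d b n) he' hSCcinv (fun ω hω => hω.2)
  -- splitting along `C` (everything is a finite sum, but we use the measure structure: all sets of the
  -- finite configuration space are measurable)
  haveI : IsProbabilityMeasure φ := isProbabilityMeasure_rcBoxMeasure b hp hq0 n
  have hsplitS : φ.real S = φ.real (S ∩ C) + φ.real (S ∩ Cᶜ) := by
    rw [← measureReal_inter_add_sdiff₀ (s := S) (Set.toFinite C).measurableSet.nullMeasurableSet,
      Set.sdiff_eq]
  have hsplitJ : φ.real (S ∩ {ω | e' ∈ ω}) =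
      φ.real (S ∩ C ∩ {ω | e' ∈ ω}) + φ.real (S ∩ Cᶜ ∩ {ω | e' ∈ ω}) := by
    rw [← measureReal_inter_add_sdiff₀ (s := S ∩ {ω | e' ∈ ω}) (Set.toFinite C).measurableSet.nullMeasurableSet,
      Set.sdiff_eq, Set.inter_right_comm, Set.inter_right_comm S {ω | e' ∈ ω} Cᶜ]
  -- `S ∩ C ⊆ L⁻¹ D` on lattice configurations (exit lemma, twice)
  have hSC_le : φ.real (S ∩ C) ≤ φ.real (L ⁻¹' (f ⁻¹' Yx ∩ f ⁻¹' Yy ∩ (f ⁻¹' K)ᶜ)) := by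
    refine rcMeasure_real_mono_on_edgeSets G hp hq0 (boxBC d b n) fun ω hωE hω => ?_
    obtain ⟨hωS, hωC⟩ := hω
    have hωS' : L ω ∈ H ∩ (f ⁻¹' K)ᶜ := hωS
    have hnotK : f (L ω) ∉ K := hωS'.2
    have hlift : f (L ω) = L (ω \ {e'}) := (liftEdges_diff_singleton_mk hxn hyn ω).symm
    have hω₀E : ω \ {e'} ⊆ G.edgeSet := Set.sdiff_subset.trans hωE
    have hB : ∀ c ∈ boxBC d b n, (c : Site d) ∉ box d m := fun c hc => not_mem_box_of_mem_boxBC hmn hc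
    rw [hlift] at hnotK
    have hx' := exists_exit_of_reachable_sup_wired hB hω₀E (z := ⟨x, hxn⟩) (w := ⟨y, hyn⟩) hx hωC hnotK
    have hnotK' : L (ω \ {e'}) ∉ openConnVia (withinGraph ⊤ (↑(box d m) : Set (Site d))) y x := by
      intro h
      refine hnotK ?_
      have h' : x ∈ openClusterIn _ (L (ω \ {e'})) y := h
      show y ∈ openClusterIn _ (L (ω \ {e'})) x
      rw [mem_openClusterIn_iff] at h' ⊢
      exact h'.symm
    have hy' := exists_exit_of_reachable_sup_wired hB hω₀E (z := ⟨y, hyn⟩) (w := ⟨x, hxn⟩) hy hωC.symm hnotK'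
    refine ⟨⟨?_, ?_⟩, ?_⟩
    · show f (L ω) ∈ Yx
      rw [hlift]; exact hx'
    · show f (L ω) ∈ Yy
      rw [hlift]; exact hy'
    · exact hωS'.2
  -- assemble
  have hp' : p / (p + q * (1 - p)) ≤ p := by
    refine div_le_self hp.1 ?_
    nlinarith [hp.1, hp.2, hq]
  have hJeq : liftEdges (box d n) ⁻¹' ({ω : BondConfig (Site d) | s(x, y) ∈ ω} ∩ H ∩ (f ⁻¹' K)ᶜ) =
      S ∩ {ω | e' ∈ ω} := by
    rw [Set.inter_assoc]; exact liftEdges_preimage_setOf_mem_inter hxn hyn _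
  rw [rcBoxLaw_real_apply b p q n hJm, rcBoxLaw_real_apply b p q n hMm, rcBoxLaw_real_apply b p q n hDm,
    hJeq]
  change φ.real (S ∩ {ω | e' ∈ ω}) - p / (p + q * (1 - p)) * φ.real S ∈
    Set.Icc 0 ((p - p / (p + q * (1 - p))) * φ.real (L ⁻¹' (f ⁻¹' Yx ∩ f ⁻¹' Yy ∩ (f ⁻¹' K)ᶜ)))
  rw [hsplitJ, h1, h2, hsplitS]
  constructor
  · have : 0 ≤ φ.real (S ∩ C) := measureReal_nonneg
    nlinarith
  · have : 0 ≤ p - p / (p + q * (1 - p)) := sub_nonneg.2 hp'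
    nlinarith

end FiniteVolume

/-! ### Infinite volume: the `K_e` half of (4.38), no uniqueness needed -/

section InfiniteVolume

variable {b : Bool} {p q : ℝ} {P : Measure (BondConfig (Site d))}

/-- Real-valued monotone convergence for a finite measure. [folklore] -/
theorem tendsto_measureReal_iUnion_of_monotone {α : Type*} {mα : MeasurableSpace α} (μ : Measure α)
    [IsFiniteMeasure μ] {s : ℕ → Set α} (hs : Monotone s) :
    Tendsto (fun m => μ.real (s m)) atTop (𝓝 (μ.real (⋃ m, s m))) := by
  have h := tendsto_measure_iUnion_atTop (μ := μ) hs
  exact (ENNReal.tendsto_toReal (measure_ne_top μ _)).comp h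

/-- **Finite-box approximant of the `K_e` half** (limit `n → ∞` of the exact box identity): for a box
limit `P`, `x ~ y` in `Λ_m`, `H` local and determined by pairs other than `e = s(x,y)`:
`P({e open} ∩ H ∩ L_m) = p · P(H ∩ L_m)`, `L_m = {x ↔ y inside Λ_m off e}`.
[cite: Grimmett2006, Thm. (4.31) proof, eq. (4.45)–(4.46)] -/
theorem IsBoxLimit.real_edgeOpen_inter_openConnVia_eq_mul (hP : IsBoxLimit d b p q P)
    (hp : p ∈ Set.Icc (0 : ℝ) 1) (hq : 0 < q) {m : ℕ} {x y : Site d} (hxy : (zdGraph d).Adj x y)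
    (hx : x ∈ box d m) (hy : y ∈ box d m) {H : Set (BondConfig (Site d))}
    {T : Finset (Sym2 (Site d))} (hH : DeterminedBy H ↑T) (heT : s(x, y) ∉ T) :
    P.real ({ω | s(x, y) ∈ ω} ∩ H ∩
        (fun η => η \ {s(x, y)}) ⁻¹' openConnVia (withinGraph ⊤ (↑(box d m) : Set (Site d))) x y) =
      p * P.real (H ∩ (fun η => η \ {s(x, y)}) ⁻¹' openConnVia (withinGraph ⊤ (↑(box d m) : Set (Site d))) x y) := by
  have hHl : IsLocalEvent H := ⟨T, hH⟩
  have hKl := isLocalEvent_openConnVia_withinGraph_box m x y (d := d)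
  have h1 := hP.tendsto_real (isLocalEvent_setOf_mem_inter_inter_preimage s(x, y) hHl hKl)
  have h2 := (hP.tendsto_real (isLocalEvent_inter_preimage s(x, y) hHl hKl)).const_mul p
  refine tendsto_nhds_unique h1 (h2.congr' ?_)
  filter_upwards [eventually_ge_atTop m] with n hn
  exact (rcBoxLaw_real_edgeOpen_inter_eq_mul_of_openConnVia b hp hq hn hxy hx hy hH
    (fun h => heT (Finset.mem_coe.1 h)) (measurableSet_of_isLocalEvent_holds hHl)).symm

/-- **Grimmett 2006, Prop. (4.37) eq. (4.38), first case, for every box limit** (`φ^b_{p,q} ∈ R_{p,q}`,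
Thm. (4.34)(b), the half that needs no uniqueness): for `P` a box limit (`0 ≤ p ≤ 1`, `q > 0`, either
boundary condition), every lattice edge `e = ⟨x,y⟩` and every event `H` determined by finitely many
pairs other than `e`, `P({e open} ∩ H ∩ K_e) = p · P(H ∩ K_e)`, where `K_e = {x ↔ y in ω ∖ e}`:
conditionally on `T_e`, on `K_e` the edge `e` is open with probability `p`.
[cite: Grimmett2006, Thm. (4.34)(b) with Prop. (4.37) eq. (4.38)] -/
theorem IsBoxLimit.real_edgeOpen_inter_offEdgeConn_eq_mul (hP : IsBoxLimit d b p q P)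
    (hp : p ∈ Set.Icc (0 : ℝ) 1) (hq : 0 < q) {x y : Site d} (hxy : (zdGraph d).Adj x y)
    {H : Set (BondConfig (Site d))} {T : Finset (Sym2 (Site d))} (hH : DeterminedBy H ↑T)
    (heT : s(x, y) ∉ T) :
    P.real ({ω | s(x, y) ∈ ω} ∩ H ∩ (fun η => η \ {s(x, y)}) ⁻¹' openConn x y) =
      p * P.real (H ∩ (fun η => η \ {s(x, y)}) ⁻¹' openConn x y) := by
  classical
  haveI := hP.isProbabilityMeasure
  obtain ⟨m₀, hm₀⟩ := DCT16.exists_subset_box ({x, y} : Finset (Site d))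
  have hx : ∀ m, m₀ ≤ m → x ∈ box d m := fun m hm => box_mono d hm (hm₀ (by simp))
  have hy : ∀ m, m₀ ≤ m → y ∈ box d m := fun m hm => box_mono d hm (hm₀ (by simp))
  set f : BondConfig (Site d) → BondConfig (Site d) := fun η => η \ {s(x, y)} with hf
  set Km : ℕ → Set (BondConfig (Site d)) :=
    fun m => openConnVia (withinGraph ⊤ (↑(box d m) : Set (Site d))) x y with hKm
  have hmono : Monotone Km := monotone_openConnVia_withinGraph_box x y
  have hunion : (⋃ m, Km m) = openConn x y := (openConn_eq_iUnion_openConnVia_box x y).symm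
  -- both sides converge as `m → ∞`
  have hA : Monotone fun m => {ω : BondConfig (Site d) | s(x, y) ∈ ω} ∩ H ∩ f ⁻¹' Km m :=
    fun m m' hmm' => Set.inter_subset_inter_right _ (Set.preimage_mono (hmono hmm'))
  have hB : Monotone fun m => H ∩ f ⁻¹' Km m :=
    fun m m' hmm' => Set.inter_subset_inter_right _ (Set.preimage_mono (hmono hmm'))
  have h1 := tendsto_measureReal_iUnion_of_monotone P hA
  have h2 := (tendsto_measureReal_iUnion_of_monotone P hB).const_mul p
  rw [← Set.inter_iUnion, ← Set.preimage_iUnion, hunion] at h1 h2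
  refine tendsto_nhds_unique h1 (h2.congr' ?_)
  filter_upwards [eventually_ge_atTop m₀] with m hm
  exact (hP.real_edgeOpen_inter_openConnVia_eq_mul hp hq hxy (hx m hm) (hy m hm) hH heT).symm

/-- The same for THE limit `rcLimit d b p q` (`0 ≤ p ≤ 1`, `q ≥ 1`). [cite: Grimmett2006, Thm. (4.34)(b) with Prop. (4.37) eq. (4.38)] -/
theorem rcLimit_real_edgeOpen_inter_offEdgeConn_eq_mul (b : Bool) (hp : p ∈ Set.Icc (0 : ℝ) 1)
    (hq : 1 ≤ q) {x y : Site d} (hxy : (zdGraph d).Adj x y) {H : Set (BondConfig (Site d))}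
    {T : Finset (Sym2 (Site d))} (hH : DeterminedBy H ↑T) (heT : s(x, y) ∉ T) :
    (rcLimit d b p q).real ({ω | s(x, y) ∈ ω} ∩ H ∩ (fun η => η \ {s(x, y)}) ⁻¹' openConn x y) =
      p * (rcLimit d b p q).real (H ∩ (fun η => η \ {s(x, y)}) ⁻¹' openConn x y) :=
  (isBoxLimit_rcLimit b hp hq).real_edgeOpen_inter_offEdgeConn_eq_mul hp (one_pos.trans_le hq) hxy hH heT

end InfiniteVolume

end Summit.CriticalPhenomena.PercolationContinuityZ3.Theorems.FK

end
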